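import Mathlib.Analysis.Calculus.MeanValue
import Mathlib.Analysis.Calculus.Deriv.Pow
import Mathlib.Analysis.Calculus.Deriv.Mul
import Mathlib.Analysis.Complex.RealDeriv
import Mathlib.Analysis.SpecialFunctions.Pow.Real
import HarnessLib

/-!
# Calculus of a harmonic phase `F = Im G` along lattice lines: directional derivatives, Lipschitz and
# Taylor bounds, and the Hessian identity `F_de² - F_dd F_ee = |G''|² (Im d ē)²`

Topic `Literature/NumberTheory/LFunctions` (toolkit for the two-dimensional van der Corput method on `ℤ[i]`,
files `TransverseStationarySum.lean`, `WeightedBProcess.lean`).  Everything here is PROVED; the only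
definition is the hypothesis structure `VdC.HolChain` (a chain of four complex derivatives on a set).

For `G` holomorphic near a convex set `T ⊂ ℂ` with derivatives `G₁, G₂, G₃, G₄` and a lattice basis `d, e`,
the real phase `F = Im G` has along the line `a ↦ a d + c e` the derivatives
`F_d = Im(G₁ d)`, `F_dd = Im(G₂ d²)`, `F_ddd = Im(G₃ d³)`, `F_dddd = Im(G₄ d⁴)` (`hasDerivAt_im_line`), the
mixed second derivatives `F_de = Im(G₂ d e)`, `F_ee = Im(G₂ e²)`, and:

* `norm_taylor3_le`, `norm_taylor2_deriv_le` — `‖G(z+v) - G(z) - G₁(z)v - G₂(z)v²/2‖ ≤ B₃‖v‖³` and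
  `‖G₁(z+v) - G₁(z) - G₂(z)v‖ ≤ B₃‖v‖²` when `‖G₃‖ ≤ B₃` on `T ∋ z, z + v` (three mean-value steps on
  `t ↦ G(z + tv)`; constant `1` in place of `1/6`, `1/2`);
* `abs_taylorF_le`, `abs_taylorFd_le` — the same for `F`, `F_d` with the step `v = s d + σ e`, in the exact
  shape of the hypotheses `taylorF`, `taylorFd` of `VdC.TransverseHyp`;
* `abs_Fdd_sub_le` — `F_dd` is `B₃‖d‖²`-Lipschitz on `T`;
* `hessian_identity` — `Im(G₂de)² - Im(G₂d²) Im(G₂e²) = ‖G₂‖² Im(d ē)²` (so the Hessian of a harmonic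
  phase is non-degenerate as soon as `G₂ ≠ 0` and `d, e` are `ℝ`-independent).

## References

* E. C. Titchmarsh, *On Epstein's zeta-function*, Proc. London Math. Soc. (2) 36 (1934), 485–500, §2 (phases
  `Im(w log z)`). [Titchmarsh1935Lattice]
* E. Krätzel, *Lattice Points*, Kluwer 1988, §2.2. [Kratzel1988]
-/

noncomputable section

open Set Complex

namespace Literature.NumberTheory.LFunctions
namespace VdC

/-- A chain of four complex derivatives on a set `U`: `G' = G₁`, `G₁' = G₂`, `G₂' = G₃`, `G₃' = G₄` at every
point of `U`. [folklore] -/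
structure HolChain (U : Set ℂ) (G G₁ G₂ G₃ G₄ : ℂ → ℂ) : Prop where
  d1 : ∀ z ∈ U, HasDerivAt G (G₁ z) z
  d2 : ∀ z ∈ U, HasDerivAt G₁ (G₂ z) z
  d3 : ∀ z ∈ U, HasDerivAt G₂ (G₃ z) z
  d4 : ∀ z ∈ U, HasDerivAt G₃ (G₄ z) z

/-! ### Derivatives along a real line -/

/-- The parametrised line `a ↦ a d + c e` has derivative `d`. [folklore] -/
theorem hasDerivAt_line (d e : ℂ) (c a : ℝ) : HasDerivAt (fun a : ℝ => (a : ℂ) * d + (c : ℂ) * e) d a := by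
  have h1 : HasDerivAt (fun a : ℝ => (a : ℂ)) 1 a := Complex.ofRealCLM.hasDerivAt
  simpa using (h1.mul_const d).add_const ((c : ℂ) * e)

/-- The parametrised segment `t ↦ z + t v` has derivative `v`. [folklore] -/
theorem hasDerivAt_seg (z v : ℂ) (t : ℝ) : HasDerivAt (fun t : ℝ => z + (t : ℂ) * v) v t := by
  have h1 : HasDerivAt (fun t : ℝ => (t : ℂ)) 1 t := Complex.ofRealCLM.hasDerivAt
  simpa using (h1.mul_const v).const_add z

/-- **Chain rule along a line, imaginary part.**  If `K' = K₁` at `a d + c e` then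
`a ↦ Im(K(ad + ce) q)` has derivative `Im(K₁(ad + ce) d q)`. [folklore] -/
theorem hasDerivAt_im_line {K K₁ : ℂ → ℂ} {d e : ℂ} {c a : ℝ} (q : ℂ)
    (hK : HasDerivAt K (K₁ ((a : ℂ) * d + (c : ℂ) * e)) ((a : ℂ) * d + (c : ℂ) * e)) :
    HasDerivAt (fun a : ℝ => (K ((a : ℂ) * d + (c : ℂ) * e) * q).im) ((K₁ ((a : ℂ) * d + (c : ℂ) * e) * d * q).im) a := by
  have hcomp := (hK.comp a (hasDerivAt_line d e c a)).mul_const q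
  have him := Complex.imCLM.hasFDerivAt.comp_hasDerivAt a hcomp
  simpa [Function.comp_def] using him

/-- **Chain rule along a segment, complex values.**  If `K' = K₁` at `z + tv` then
`t ↦ K(z + tv)` has derivative `K₁(z + tv) v`. [folklore] -/
theorem hasDerivAt_comp_seg {K K₁ : ℂ → ℂ} {z v : ℂ} {t : ℝ}
    (hK : HasDerivAt K (K₁ (z + (t : ℂ) * v)) (z + (t : ℂ) * v)) :
    HasDerivAt (fun t : ℝ => K (z + (t : ℂ) * v)) (K₁ (z + (t : ℂ) * v) * v) t :=
  hK.comp t (hasDerivAt_seg z v t)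

/-! ### Taylor bounds along a segment -/

/-- Points of the segment `[z, z + v]` lie in a convex `T ∋ z, z + v`. [folklore] -/
theorem seg_mem {T : Set ℂ} (hT : Convex ℝ T) {z v : ℂ} (hz : z ∈ T) (hzv : z + v ∈ T) {t : ℝ}
    (ht : t ∈ Icc (0 : ℝ) 1) : z + (t : ℂ) * v ∈ T := by
  have := hT hz hzv (by linarith [ht.2] : (0 : ℝ) ≤ 1 - t) ht.1 (by ring)
  have heq : (1 - t) • z + t • (z + v) = z + (t : ℂ) * v := by
    simp only [Complex.real_smul]; push_cast; ring
  rwa [heq] at this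

section Taylor

variable {U T : Set ℂ} {G G₁ G₂ G₃ G₄ : ℂ → ℂ} (H : HolChain U G G₁ G₂ G₃ G₄)
  (hT : Convex ℝ T) (hTU : T ⊆ U) {B₃ : ℝ} (hB₃ : ∀ z ∈ T, ‖G₃ z‖ ≤ B₃)
include H hT hTU hB₃

/-- **Second-order Taylor bound for `G₁`**: `‖G₁(z+v) - G₁(z) - G₂(z) v‖ ≤ B₃ ‖v‖²` for `z, z + v ∈ T`.
[folklore] -/
theorem norm_taylor2_deriv_le {z v : ℂ} (hz : z ∈ T) (hzv : z + v ∈ T) :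
    ‖G₁ (z + v) - G₁ z - G₂ z * v‖ ≤ B₃ * ‖v‖ ^ 2 := by
  have hB : 0 ≤ B₃ := (norm_nonneg _).trans (hB₃ z hz)
  -- `k(t) = G₁(z + tv) - G₁ z - t G₂ z v`, `k' = (G₂(z+tv) - G₂ z) v`, `k'' = G₃(z+tv) v²`
  set k₁ : ℝ → ℂ := fun t => (G₂ (z + (t : ℂ) * v) - G₂ z) * v with hk₁
  have hk₁d : ∀ t ∈ Icc (0 : ℝ) 1, HasDerivAt k₁ (G₃ (z + (t : ℂ) * v) * v * v) t := by
    intro t ht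
    have h := hasDerivAt_comp_seg (H.d3 _ (hTU (seg_mem hT hz hzv ht)))
    simpa [hk₁] using (h.sub_const (G₂ z)).mul_const v
  have hk₁b : ∀ t ∈ Icc (0 : ℝ) 1, ‖k₁ t‖ ≤ B₃ * ‖v‖ ^ 2 := by
    intro t ht
    have := norm_image_sub_le_of_norm_deriv_le_segment' (f := k₁) (a := 0) (b := 1)
      (fun s hs => (hk₁d s hs).hasDerivWithinAt)
      (fun s hs => by
        rw [norm_mul, norm_mul]
        have := hB₃ _ (seg_mem hT hz hzv (Ico_subset_Icc_self hs))
        calc ‖G₃ (z + (s : ℂ) * v)‖ * ‖v‖ * ‖v‖ ≤ B₃ * ‖v‖ * ‖v‖ := by gcongr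
          _ = B₃ * ‖v‖ ^ 2 := by ring) t ht
    simp only [hk₁, Complex.ofReal_zero, zero_mul, add_zero, sub_self, zero_mul, sub_zero] at this
    calc ‖k₁ t‖ = ‖(G₂ (z + (t : ℂ) * v) - G₂ z) * v‖ := rfl
      _ ≤ B₃ * ‖v‖ ^ 2 * t := this
      _ ≤ B₃ * ‖v‖ ^ 2 := by
          have : 0 ≤ B₃ * ‖v‖ ^ 2 := by positivity
          nlinarith [ht.2]
  set k : ℝ → ℂ := fun t => G₁ (z + (t : ℂ) * v) - G₁ z - (t : ℂ) * (G₂ z * v) with hk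
  have hkd : ∀ t ∈ Icc (0 : ℝ) 1, HasDerivAt k (k₁ t) t := by
    intro t ht
    have h := hasDerivAt_comp_seg (H.d2 _ (hTU (seg_mem hT hz hzv ht)))
    have h1 : HasDerivAt (fun t : ℝ => (t : ℂ)) 1 t := Complex.ofRealCLM.hasDerivAt
    have h2 : HasDerivAt (fun t : ℝ => (t : ℂ) * (G₂ z * v)) (G₂ z * v) t := by
      simpa using h1.mul_const (G₂ z * v)
    have h3 := (h.sub_const (G₁ z)).sub h2
    have h4 : HasDerivAt k (G₂ (z + (t : ℂ) * v) * v - G₂ z * v) t :=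
      h3.congr_of_eventuallyEq (Filter.Eventually.of_forall fun y => by simp only [hk, Pi.sub_apply])
    refine h4.congr_deriv ?_
    simp only [hk₁]; ring
  have := norm_image_sub_le_of_norm_deriv_le_segment' (f := k) (a := 0) (b := 1)
    (fun s hs => (hkd s hs).hasDerivWithinAt) (fun s hs => hk₁b s (Ico_subset_Icc_self hs)) 1
    (right_mem_Icc.2 zero_le_one)
  simpa [hk] using this

/-- **Third-order Taylor bound**: `‖G(z+v) - G(z) - G₁(z) v - G₂(z) v²/2‖ ≤ B₃ ‖v‖³` for `z, z + v ∈ T`.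
[folklore] -/
theorem norm_taylor3_le {z v : ℂ} (hz : z ∈ T) (hzv : z + v ∈ T) :
    ‖G (z + v) - G z - G₁ z * v - G₂ z * v ^ 2 / 2‖ ≤ B₃ * ‖v‖ ^ 3 := by
  have hB : 0 ≤ B₃ := (norm_nonneg _).trans (hB₃ z hz)
  -- `k(t) = G(z+tv) - G z - t G₁ z v - t² G₂ z v²/2`, `k' = G₁(z+tv)v - G₁ z v - t G₂ z v²`
  set k₁ : ℝ → ℂ := fun t => (G₁ (z + (t : ℂ) * v) - G₁ z - G₂ z * ((t : ℂ) * v)) * v with hk₁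
  have hk₁b : ∀ t ∈ Icc (0 : ℝ) 1, ‖k₁ t‖ ≤ B₃ * ‖v‖ ^ 3 := by
    intro t ht
    have hmem : z + (t : ℂ) * v ∈ T := seg_mem hT hz hzv ht
    have h := norm_taylor2_deriv_le H hT hTU hB₃ hz hmem
    rw [hk₁, norm_mul]
    have ht1 : ‖(t : ℂ) * v‖ ≤ ‖v‖ := by
      rw [norm_mul, Complex.norm_real, Real.norm_eq_abs, abs_of_nonneg ht.1]
      nlinarith [norm_nonneg v, ht.2]
    calc ‖G₁ (z + (t : ℂ) * v) - G₁ z - G₂ z * ((t : ℂ) * v)‖ * ‖v‖ ≤ B₃ * ‖(t : ℂ) * v‖ ^ 2 * ‖v‖ := by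
          gcongr
      _ ≤ B₃ * ‖v‖ ^ 2 * ‖v‖ := by gcongr
      _ = B₃ * ‖v‖ ^ 3 := by ring
  set k : ℝ → ℂ := fun t => G (z + (t : ℂ) * v) - G z - (t : ℂ) * (G₁ z * v) - ((t ^ 2 : ℝ) : ℂ) * (G₂ z * v ^ 2 / 2)
    with hk
  have hkd : ∀ t ∈ Icc (0 : ℝ) 1, HasDerivAt k (k₁ t) t := by
    intro t ht
    have h := hasDerivAt_comp_seg (H.d1 _ (hTU (seg_mem hT hz hzv ht)))
    have h1 : HasDerivAt (fun t : ℝ => (t : ℂ)) 1 t := Complex.ofRealCLM.hasDerivAt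
    have h2 : HasDerivAt (fun t : ℝ => (t : ℂ) * (G₁ z * v)) (G₁ z * v) t := by
      simpa using h1.mul_const (G₁ z * v)
    have hsq : HasDerivAt (fun t : ℝ => t ^ 2) (2 * t) t := by
      simpa using ((hasDerivAt_id t).fun_pow 2)
    have h3 : HasDerivAt (fun t : ℝ => ((t ^ 2 : ℝ) : ℂ) * (G₂ z * v ^ 2 / 2)) (((2 * t : ℝ) : ℂ) * (G₂ z * v ^ 2 / 2)) t :=
      hsq.ofReal_comp.mul_const _
    have h5 := ((h.sub_const (G z)).sub h2).sub h3
    have h6 : HasDerivAt k (G₁ (z + (t : ℂ) * v) * v - G₁ z * v - ((2 * t : ℝ) : ℂ) * (G₂ z * v ^ 2 / 2)) t :=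
      h5.congr_of_eventuallyEq (Filter.Eventually.of_forall fun y => by simp only [hk, Pi.sub_apply])
    refine h6.congr_deriv ?_
    simp only [hk₁]
    push_cast
    ring
  have := norm_image_sub_le_of_norm_deriv_le_segment' (f := k) (a := 0) (b := 1)
    (fun s hs => (hkd s hs).hasDerivWithinAt) (fun s hs => hk₁b s (Ico_subset_Icc_self hs)) 1
    (right_mem_Icc.2 zero_le_one)
  simpa [hk] using this

/-- **Lipschitz bound for `G₂` on `T`**: `‖G₂ z - G₂ z'‖ ≤ B₃ ‖z - z'‖`. [folklore] -/
theorem norm_G₂_sub_le {z z' : ℂ} (hz : z ∈ T) (hz' : z' ∈ T) : ‖G₂ z - G₂ z'‖ ≤ B₃ * ‖z - z'‖ :=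
  hT.norm_image_sub_le_of_norm_hasDerivWithin_le (fun x hx => (H.d3 x (hTU hx)).hasDerivWithinAt) hB₃ hz' hz

end Taylor

/-! ### The real phase `F = Im G` and its directional derivatives -/

/-- Linearity: `Im(K (s d + σ e)) = s Im(K d) + σ Im(K e)` for real `s, σ`. [folklore] -/
theorem im_mul_step (K d e : ℂ) (s σ : ℝ) :
    (K * ((s : ℂ) * d + (σ : ℂ) * e)).im = s * (K * d).im + σ * (K * e).im := by
  simp only [mul_add, Complex.add_im, Complex.mul_im, Complex.mul_re, Complex.ofReal_re, Complex.ofReal_im]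
  ring

/-- The quadratic form: `Im(K (s d + σ e)²) = s² Im(K d²) + 2 s σ Im(K d e) + σ² Im(K e²)`. [folklore] -/
theorem im_mul_step_sq (K d e : ℂ) (s σ : ℝ) :
    (K * ((s : ℂ) * d + (σ : ℂ) * e) ^ 2).im
      = s ^ 2 * (K * d ^ 2).im + 2 * s * σ * (K * d * e).im + σ ^ 2 * (K * e ^ 2).im := by
  have : K * ((s : ℂ) * d + (σ : ℂ) * e) ^ 2
      = ((s ^ 2 : ℝ) : ℂ) * (K * d ^ 2) + ((2 * s * σ : ℝ) : ℂ) * (K * d * e) + ((σ ^ 2 : ℝ) : ℂ) * (K * e ^ 2) := by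
    push_cast; ring
  rw [this]
  simp only [Complex.add_im, Complex.mul_im, Complex.ofReal_re, Complex.ofReal_im]
  ring

/-- **The Hessian identity** for a harmonic phase: `Im(K d e)² - Im(K d²) Im(K e²) = ‖K‖² Im(d ē)²`.
[folklore] -/
theorem hessian_identity (K d e : ℂ) :
    (K * d * e).im ^ 2 - (K * d ^ 2).im * (K * e ^ 2).im = ‖K‖ ^ 2 * (d * (starRingEnd ℂ) e).im ^ 2 := by
  rw [Complex.sq_norm, Complex.normSq_apply]
  simp only [Complex.mul_im, Complex.mul_re, sq, Complex.conj_re, Complex.conj_im]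
  ring

section Phase

variable {U T : Set ℂ} {G G₁ G₂ G₃ G₄ : ℂ → ℂ} (H : HolChain U G G₁ G₂ G₃ G₄)
  (hT : Convex ℝ T) (hTU : T ⊆ U) {B₃ : ℝ} (hB₃ : ∀ z ∈ T, ‖G₃ z‖ ≤ B₃) (d e : ℂ)
include H hT hTU hB₃

/-- **Taylor bound for `F = Im G`** in the shape of `TransverseHyp.taylorF`: for `z, z + (sd + σe) ∈ T`,
`|F(z+v) - F(z) - (s F_d + σ F_e) - (s² F_dd + 2sσ F_de + σ² F_ee)/2| ≤ B₃ ‖sd + σe‖³`. [folklore] -/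
theorem abs_taylorF_le {z : ℂ} (hz : z ∈ T) {s σ : ℝ} (hzv : z + ((s : ℂ) * d + (σ : ℂ) * e) ∈ T) :
    |(G (z + ((s : ℂ) * d + (σ : ℂ) * e))).im - (G z).im - (s * (G₁ z * d).im + σ * (G₁ z * e).im)
        - (s ^ 2 * (G₂ z * d ^ 2).im + 2 * s * σ * (G₂ z * d * e).im + σ ^ 2 * (G₂ z * e ^ 2).im) / 2|
      ≤ B₃ * ‖(s : ℂ) * d + (σ : ℂ) * e‖ ^ 3 := by
  set v : ℂ := (s : ℂ) * d + (σ : ℂ) * e with hv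
  have h := norm_taylor3_le H hT hTU hB₃ hz hzv
  have heq : (G (z + v)).im - (G z).im - (s * (G₁ z * d).im + σ * (G₁ z * e).im)
        - (s ^ 2 * (G₂ z * d ^ 2).im + 2 * s * σ * (G₂ z * d * e).im + σ ^ 2 * (G₂ z * e ^ 2).im) / 2
      = (G (z + v) - G z - G₁ z * v - G₂ z * v ^ 2 / 2).im := by
    rw [hv, ← im_mul_step, ← im_mul_step_sq]
    simp only [Complex.sub_im]
    rw [Complex.div_ofNat_im]
  rw [heq]
  exact (Complex.abs_im_le_norm _).trans h

/-- **Taylor bound for `F_d = Im(G₁ d)`** in the shape of `TransverseHyp.taylorFd`: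
`|F_d(z+v) - F_d(z) - (s F_dd + σ F_de)| ≤ B₃ ‖d‖ ‖sd + σe‖²`. [folklore] -/
theorem abs_taylorFd_le {z : ℂ} (hz : z ∈ T) {s σ : ℝ} (hzv : z + ((s : ℂ) * d + (σ : ℂ) * e) ∈ T) :
    |(G₁ (z + ((s : ℂ) * d + (σ : ℂ) * e)) * d).im - (G₁ z * d).im - (s * (G₂ z * d ^ 2).im + σ * (G₂ z * d * e).im)|
      ≤ B₃ * ‖d‖ * ‖(s : ℂ) * d + (σ : ℂ) * e‖ ^ 2 := by
  set v : ℂ := (s : ℂ) * d + (σ : ℂ) * e with hv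
  have h := norm_taylor2_deriv_le H hT hTU hB₃ hz hzv
  have heq : (G₁ (z + v) * d).im - (G₁ z * d).im - (s * (G₂ z * d ^ 2).im + σ * (G₂ z * d * e).im)
      = ((G₁ (z + v) - G₁ z - G₂ z * v) * d).im := by
    have : s * (G₂ z * d ^ 2).im + σ * (G₂ z * d * e).im = (G₂ z * v * d).im := by
      rw [hv, show G₂ z * ((s : ℂ) * d + (σ : ℂ) * e) * d = (G₂ z * d) * ((s : ℂ) * d + (σ : ℂ) * e) by ring,
        im_mul_step]
      ring_nf
    rw [this]
    simp only [sub_mul, Complex.sub_im]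
  rw [heq]
  refine (Complex.abs_im_le_norm _).trans ?_
  rw [norm_mul]
  calc ‖G₁ (z + v) - G₁ z - G₂ z * v‖ * ‖d‖ ≤ B₃ * ‖v‖ ^ 2 * ‖d‖ := by gcongr
    _ = B₃ * ‖d‖ * ‖v‖ ^ 2 := by ring

/-- **`F_dd = Im(G₂ d²)` is Lipschitz on `T`**: `|F_dd z - F_dd z'| ≤ B₃ ‖d‖² ‖z - z'‖`. [folklore] -/
theorem abs_Fdd_sub_le {z z' : ℂ} (hz : z ∈ T) (hz' : z' ∈ T) :
    |(G₂ z * d ^ 2).im - (G₂ z' * d ^ 2).im| ≤ B₃ * ‖d‖ ^ 2 * ‖z - z'‖ := by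
  have h := norm_G₂_sub_le H hT hTU hB₃ hz hz'
  rw [← Complex.sub_im, ← sub_mul]
  refine (Complex.abs_im_le_norm _).trans ?_
  rw [norm_mul, norm_pow]
  calc ‖G₂ z - G₂ z'‖ * ‖d‖ ^ 2 ≤ B₃ * ‖z - z'‖ * ‖d‖ ^ 2 := by gcongr
    _ = B₃ * ‖d‖ ^ 2 * ‖z - z'‖ := by ring

end Phase

/-- `|Im(K q)| ≤ ‖K‖ ‖q‖`. [folklore] -/
theorem abs_im_mul_le (K q : ℂ) : |(K * q).im| ≤ ‖K‖ * ‖q‖ :=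
  (Complex.abs_im_le_norm _).trans (le_of_eq (norm_mul _ _))

/-- `‖s d + σ e‖ ≤ (|s| + 1) max(‖d‖, ‖e‖)` for `|σ| ≤ 1`. [folklore] -/
theorem norm_step_le_max {d e : ℂ} {s σ : ℝ} (hσ : |σ| ≤ 1) :
    ‖(s : ℂ) * d + (σ : ℂ) * e‖ ≤ (|s| + 1) * max ‖d‖ ‖e‖ := by
  refine (norm_add_le _ _).trans ?_
  rw [norm_mul, norm_mul, Complex.norm_real, Complex.norm_real, Real.norm_eq_abs, Real.norm_eq_abs]
  have hd : ‖d‖ ≤ max ‖d‖ ‖e‖ := le_max_left _ _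
  have he : ‖e‖ ≤ max ‖d‖ ‖e‖ := le_max_right _ _
  have h0 : 0 ≤ max ‖d‖ ‖e‖ := (norm_nonneg _).trans hd
  nlinarith [abs_nonneg s, mul_le_mul_of_nonneg_left hd (abs_nonneg s), mul_le_mul hσ he (norm_nonneg _) zero_le_one]

end VdC
end Literature.NumberTheory.LFunctions

end
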